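/-
Copyright (c) 2026 the pub-hodgecm-mathlib formalisation cell (harness21).  Prover seat hodgecm-mathlib-K2E1-p12 (g0), Track B ∕ K2-LIT, h413 = `stmt-HodgeConjecture-24833`,
line `K2_E1_TraceFormulaBeta`, campaign «R8₂-sph EXHAUSTION», ROADCARD row T5 (isometry half), dealer K2E1-plan (g7) deals (136)(ii)∕(143): the inner product formula on the
unitary axis rewritten as a manifestly Hermitian form on `ℂ ⊕ L²((0,∞))` — FAMILY-GENERIC (abstract transforms `Φ, Ψ`, abstract axis scalar `s`, abstract constants).
-/
import Summits.HodgeConjecture.HodgeConjecture.Theorems.K2E1MellinPaleyWienerHalfLine       -- ★ A p859444 (K2E3-p12): only `conj_vertical` (`conj (σ + iy) = σ + i(−y)`) is used; keeps the import cone of the T4∕T5 chain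
import Mathlib.MeasureTheory.Measure.Lebesgue.Integral                                      -- Mathlib: `integral_comp_neg_Ioi`
import Mathlib.MeasureTheory.Integral.IntervalIntegral.Basic                                 -- Mathlib: `intervalIntegral.integral_Iic_add_Ioi`
import HarnessLib

/-!
# T5a — `K2E1PseudoEisensteinPlancherelIsometry`: the unitary-axis inner product formula as the Hermitian form `⟪Uθ, Uθ′⟫` on `ℂ ⊕ L²((0,∞))` (family-generic)

Track B ∕ K2-LIT, crux h413 = `stmt-HodgeConjecture-24833`, route of record `HCCMUnconditional`; cell `hodgecm-mathlib`, squad K2, ENGINE E1.  THEOREMS ONLY (no `def`, no `instance`,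
no `notation`, no `sorry`; default heartbeats); lane `--supports stmt-HodgeConjecture-24833 --as helper` (count-neutral).  No automorphic object: pure analysis on the line.

THE MATHEMATICS ([MoeglinWaldspurger1995, II.2.4, IV.3.12 (b)]; [Iwaniec2002, §7.3 (Plancherel for the continuous spectrum)]; [Langlands1976, §7]).  After the contour shift (★ T4b ∕ ★ (136))
the inner product of two pseudo-Eisenstein series of ONE cuspidal-datum family at level `K_U` reads
`⟪θ, θ′⟫ = C·ρ·Φ(−1)·conj Ψ(−1) + C·k·∫_ℝ Φ(−z)·(conj Ψ(−(1−z̄)) + s(z)·conj Ψ(−z̄)) dy`, `z = ½ + iy`, with `Φ, Ψ` the transforms of the test data (radial family: `mellin f`, `mellin f′`),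
`s` the axis scalar (radial family: the continued `(ν𝓕)⁻¹·c = cI`; an unramified `χ`-family: the scalar through which the intertwining matrix acts on the `K_U`-fixed line), `ρ` the
residue datum, `k = (2π)⁻¹`.  ON THE AXIS `1 − z̄ = z` and `z̄ = ½ − iy`, so with `A(t) := Φ(−(½+it))`, `A′(t) := Ψ(−(½+it))`, `c(t) := s(½+it)` the integrand is
`G(t) = A(t)·(conj A′(t) + c(t)·conj A′(−t))` (§3).  If the scalar is UNITARY and REFLECTION-SYMMETRIC on the axis — `|c(t)| = 1`, `c(−t) = conj c(t)` (★ T2 ∘ (FE), ★ (136) §2) — then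
(§2) `(A(t) + c(−t)A(−t))·conj(A′(t) + c(−t)A′(−t)) = G(t) + G(−t)`, and (§1) `∫_ℝ G = ∫_0^∞ (G(t) + G(−t)) dt`.  HENCE (§4 HEAD) **`plancherelForm_of_innerProductFormula`**:
`⟪θ, θ′⟫ = C·ρ·Φ(−1)·conj Ψ(−1) + C·k·∫_0^∞ U(t)·conj U′(t) dt`, `U(t) = Φ(−(½+it)) + s(½−it)·Φ(−(½−it))` — the pairing of `Uθ := (Φ(−1), U)` and `Uθ′` in `ℂ ⊕ L²((0,∞))` with weights
`(C·ρ, C·k)` (ROADCARD T5: «`U θ_Φ = (φ̂(1)·√(r vol), t ↦ φ̂(½+it) + c(½−it)·φ̂(½−it))`, ISOMETRY from T4 + polarization»), and the NORM form `⟪θ, θ⟫ = C·ρ·|Φ(−1)|² + C·k·∫_0^∞ |U(t)|² dt`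
(`plancherelNorm_of_innerProductFormula`).  Family-generic by design ((143)): the radial instantiation takes `(Φ, Ψ, s, ρ, k) := (mellin f, mellin f′, cI, r, (2π)⁻¹)` from ★ (136)
`pseudoEisenstein_contourShift_of_fe`; every unramified `χ`-family instantiates from the f3-χ formula (K2E3-p12 (142)).
HONEST LABEL: HC_CM is proved only modulo the 7 printed citations (2 remaining named inputs: hLiu418 = `stmt-HodgeConjecture-24832`, h413 = `stmt-HodgeConjecture-24833`) until rung 0
closes; this file asserts no named fact, closes no socket; count-neutral; letters at instantiation: `hIP`, `hs1`, `hss`, `hG`.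

## References
* [MoeglinWaldspurger1995] C. Mœglin, J.-L. Waldspurger, *Spectral decomposition and Eisenstein series* (1995), II.2.4, IV.3.12.
* [Iwaniec2002] H. Iwaniec, *Spectral Methods of Automorphic Forms* (2nd ed., 2002), §7.3.
* [Langlands1976] R. P. Langlands, *On the Functional Equations Satisfied by Eisenstein Series*, LNM 544 (1976), §7.
-/

set_option autoImplicit false
set_option linter.dupNamespace false  -- the mandated namespace repeats the summit's segment (`HodgeConjecture.HodgeConjecture`)

noncomputable section

open MeasureTheory Measure Set Filter Topology Complex
open scoped Real ComplexConjugate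
open Summit.HodgeConjecture.HodgeConjecture.Cruxes.H413.K2E1MellinPaleyWienerHalfLine (conj_vertical)

namespace Summit.HodgeConjecture.HodgeConjecture.Cruxes.H413.K2E1PseudoEisensteinPlancherelIsometry

/-! ## §1 Folding the line onto the half-line: `∫_ℝ G = ∫_0^∞ (G(t) + G(−t)) dt` -/

/-- **`∫_ℝ G(t) dt = ∫_0^∞ (G(t) + G(−t)) dt`** for integrable `G` (split at `0`, reflect the left half: Mathlib `intervalIntegral.integral_Iic_add_Ioi`, `integral_comp_neg_Ioi`). [folklore] -/
theorem integral_eq_setIntegral_Ioi_add_comp_neg {E : Type*} [NormedAddCommGroup E] [NormedSpace ℝ E] {G : ℝ → E} (hG : Integrable G) :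
    ∫ t : ℝ, G t = ∫ t in Ioi (0 : ℝ), (G t + G (-t)) := by
  have h1 := intervalIntegral.integral_Iic_add_Ioi (hG.integrableOn (s := Iic (0 : ℝ))) (hG.integrableOn (s := Ioi (0 : ℝ)))
  have h2 : ∫ t in Iic (0 : ℝ), G t = ∫ t in Ioi (0 : ℝ), G (-t) := by
    rw [integral_comp_neg_Ioi 0 G, neg_zero]
  rw [← h1, h2, ← integral_add (hG.comp_neg.integrableOn) hG.integrableOn]
  exact integral_congr_ae (Eventually.of_forall fun t => add_comm _ _)

/-! ## §2 The pointwise Hermitian rearrangement under a unitary, reflection-symmetric axis scalar -/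

/-- **`(A(t) + c(−t)A(−t))·conj(A′(t) + c(−t)A′(−t)) = G(t) + G(−t)`**, `G(t) = A(t)·(conj A′(t) + c(t)·conj A′(−t))`, when `|c(−t)| = 1` and `c(−t) = conj c(t)` (expand; `c(−t)·conj c(−t) =
|c(−t)|² = 1`, `conj c(−t) = c(t)`). [cite: MoeglinWaldspurger1995, IV.3.12] [cite: Iwaniec2002, §7.3] -/
theorem hermitian_rearrangement {A A' c : ℝ → ℂ} (hc1 : ∀ t : ℝ, ‖c t‖ = 1) (hcs : ∀ t : ℝ, c (-t) = conj (c t)) (t : ℝ) :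
    (A t + c (-t) * A (-t)) * conj (A' t + c (-t) * A' (-t)) =
      A t * (conj (A' t) + c t * conj (A' (-t))) + A (-t) * (conj (A' (-t)) + c (-t) * conj (A' (- -t))) := by
  have h1 : c (-t) * conj (c (-t)) = 1 := by
    rw [mul_conj, normSq_eq_norm_sq, hc1 (-t)]
    norm_num
  have h2 : conj (c (-t)) = c t := by rw [hcs t, conj_conj]
  rw [neg_neg, map_add, map_mul, h2]
  have h3 : c (-t) * c t = 1 := by rw [← h2]; exact h1
  linear_combination (A (-t) * conj (A' (-t))) * h3

/-! ## §3 The axis pairing as a half-line Hermitian integral -/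

/-- **`∫_ℝ A(t)·(conj A′(t) + c(t)·conj A′(−t)) dt = ∫_0^∞ (A(t) + c(−t)A(−t))·conj(A′(t) + c(−t)A′(−t)) dt`** for a unitary, reflection-symmetric axis scalar `c` and an integrable
integrand — §1 then §2 pointwise on `(0,∞)`. [cite: MoeglinWaldspurger1995, IV.3.12] [cite: Iwaniec2002, §7.3] -/
theorem axisPairing_eq_setIntegral_Ioi {A A' c : ℝ → ℂ} (hc1 : ∀ t : ℝ, ‖c t‖ = 1) (hcs : ∀ t : ℝ, c (-t) = conj (c t))
    (hG : Integrable fun t : ℝ => A t * (conj (A' t) + c t * conj (A' (-t)))) :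
    ∫ t : ℝ, A t * (conj (A' t) + c t * conj (A' (-t))) = ∫ t in Ioi (0 : ℝ), (A t + c (-t) * A (-t)) * conj (A' t + c (-t) * A' (-t)) := by
  rw [integral_eq_setIntegral_Ioi_add_comp_neg hG]
  refine setIntegral_congr_fun measurableSet_Ioi fun t _ => ?_
  rw [hermitian_rearrangement hc1 hcs t, neg_neg]

/-- **THE NORM FORM**: with `A′ = A`, `∫_ℝ A(t)·(conj A(t) + c(t)·conj A(−t)) dt = ∫_0^∞ ‖A(t) + c(−t)A(−t)‖² dt` (a manifestly non-negative real number). [cite: Iwaniec2002, §7.3] -/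
theorem axisPairing_self_eq_setIntegral_Ioi_norm_sq {A c : ℝ → ℂ} (hc1 : ∀ t : ℝ, ‖c t‖ = 1) (hcs : ∀ t : ℝ, c (-t) = conj (c t))
    (hG : Integrable fun t : ℝ => A t * (conj (A t) + c t * conj (A (-t)))) :
    ∫ t : ℝ, A t * (conj (A t) + c t * conj (A (-t))) = ∫ t in Ioi (0 : ℝ), (((‖A t + c (-t) * A (-t)‖ ^ 2 : ℝ)) : ℂ) := by
  rw [axisPairing_eq_setIntegral_Ioi hc1 hcs hG]
  refine setIntegral_congr_fun measurableSet_Ioi fun t _ => ?_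
  rw [mul_conj, normSq_eq_norm_sq, ofReal_pow]

/-! ## §4 HEAD: the inner product formula in `⟪Uθ, Uθ′⟫` form, from the f3-shaped letter -/

/-- On the axis `z = ½ + iy`: `1 − conj z = z` and `conj z = ½ + i(−y)`, so the f3 integrand `Φ(−z)·(conj Ψ(−(1−z̄)) + s(z)·conj Ψ(−z̄))` is `A(y)·(conj A′(y) + c(y)·conj A′(−y))` with
`A = Φ(−(½+i·))`, `A′ = Ψ(−(½+i·))`, `c = s(½+i·)`. [folklore] -/
theorem axis_integrand_eq (Φ Ψ s : ℂ → ℂ) (y : ℝ) :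
    Φ (-((((1 / 2 : ℝ)) : ℂ) + y * I)) * (conj (Ψ (-(1 - conj ((((1 / 2 : ℝ)) : ℂ) + y * I)))) + s ((((1 / 2 : ℝ)) : ℂ) + y * I) * conj (Ψ (-conj ((((1 / 2 : ℝ)) : ℂ) + y * I)))) =
      Φ (-((((1 / 2 : ℝ)) : ℂ) + y * I)) * (conj (Ψ (-((((1 / 2 : ℝ)) : ℂ) + y * I))) +
        s ((((1 / 2 : ℝ)) : ℂ) + y * I) * conj (Ψ (-((((1 / 2 : ℝ)) : ℂ) + ((-y : ℝ) : ℂ) * I)))) := by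
  have h1 : 1 - conj ((((1 / 2 : ℝ)) : ℂ) + y * I) = (((1 / 2 : ℝ)) : ℂ) + y * I := by
    rw [conj_vertical]
    apply Complex.ext
    · norm_num
    · norm_num
  rw [h1, conj_vertical]

/-- **HEAD — THE PLANCHEREL FORM OF THE UNITARY-AXIS INNER PRODUCT FORMULA (ROADCARD T5, isometry half), FAMILY-GENERIC.**  Data: transforms `Φ, Ψ : ℂ → ℂ`, axis scalar `s : ℂ → ℂ`,
constants `C, ρ, k : ℂ`, and a number `IP` with the f3-shaped identity (★ T4b ∕ ★ (136) `pseudoEisenstein_contourShift_of_fe` for the radial family; K2E3-p12's f3-χ for a `χ`-family)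
**(hIP)** `IP = C·(ρ·Φ(−1)·conj Ψ(−1)) + C·(k·∫_ℝ Φ(−z)(conj Ψ(−(1−z̄)) + s(z)·conj Ψ(−z̄)) dy)`, `z = ½+iy`; the scalar unitary **(hs1)** `‖s(½+it)‖ = 1` and reflection-symmetric
**(hss)** `s(½−it) = conj s(½+it)` on the axis (★ T2 ∘ (FE); ★ (136) §2); the axis integrand integrable **(hG)** (★ T4b `integrable_innerProductIntegrand_vertical` at `σ = ½`).  THEN
**`IP = C·(ρ·Φ(−1)·conj Ψ(−1)) + C·(k·∫_0^∞ U(t)·conj U′(t) dt)`**, `U(t) = Φ(−(½+it)) + s(½−it)·Φ(−(½−it))`, `U′` likewise from `Ψ` — i.e. `⟪θ,θ′⟫ = ⟪Uθ, Uθ′⟫` in `ℂ ⊕ L²((0,∞))`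
with weights `(C·ρ, C·k)`, `Uθ = (Φ(−1), U)`. [cite: MoeglinWaldspurger1995, II.2.4, IV.3.12] [cite: Iwaniec2002, §7.3] [cite: Langlands1976, §7] -/
theorem plancherelForm_of_innerProductFormula (Φ Ψ s : ℂ → ℂ) {IP C ρ k : ℂ}
    (hIP : IP = C * (ρ * (Φ (-1) * conj (Ψ (-1)))) + C * (k * ∫ y : ℝ, Φ (-((((1 / 2 : ℝ)) : ℂ) + y * I)) *
      (conj (Ψ (-(1 - conj ((((1 / 2 : ℝ)) : ℂ) + y * I)))) + s ((((1 / 2 : ℝ)) : ℂ) + y * I) * conj (Ψ (-conj ((((1 / 2 : ℝ)) : ℂ) + y * I))))))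
    (hs1 : ∀ t : ℝ, ‖s ((((1 / 2 : ℝ)) : ℂ) + t * I)‖ = 1) (hss : ∀ t : ℝ, s ((((1 / 2 : ℝ)) : ℂ) + ((-t : ℝ) : ℂ) * I) = conj (s ((((1 / 2 : ℝ)) : ℂ) + t * I)))
    (hG : Integrable fun y : ℝ => Φ (-((((1 / 2 : ℝ)) : ℂ) + y * I)) *
      (conj (Ψ (-(1 - conj ((((1 / 2 : ℝ)) : ℂ) + y * I)))) + s ((((1 / 2 : ℝ)) : ℂ) + y * I) * conj (Ψ (-conj ((((1 / 2 : ℝ)) : ℂ) + y * I))))) :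
    IP = C * (ρ * (Φ (-1) * conj (Ψ (-1)))) + C * (k * ∫ t in Ioi (0 : ℝ),
      (Φ (-((((1 / 2 : ℝ)) : ℂ) + t * I)) + s ((((1 / 2 : ℝ)) : ℂ) + ((-t : ℝ) : ℂ) * I) * Φ (-((((1 / 2 : ℝ)) : ℂ) + ((-t : ℝ) : ℂ) * I))) *
        conj (Ψ (-((((1 / 2 : ℝ)) : ℂ) + t * I)) + s ((((1 / 2 : ℝ)) : ℂ) + ((-t : ℝ) : ℂ) * I) * Ψ (-((((1 / 2 : ℝ)) : ℂ) + ((-t : ℝ) : ℂ) * I)))) := by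
  -- the axis functions
  set A : ℝ → ℂ := fun t => Φ (-((((1 / 2 : ℝ)) : ℂ) + t * I)) with hA
  set A' : ℝ → ℂ := fun t => Ψ (-((((1 / 2 : ℝ)) : ℂ) + t * I)) with hA'
  set c : ℝ → ℂ := fun t => s ((((1 / 2 : ℝ)) : ℂ) + t * I) with hc
  have hint : (fun y : ℝ => Φ (-((((1 / 2 : ℝ)) : ℂ) + y * I)) *
      (conj (Ψ (-(1 - conj ((((1 / 2 : ℝ)) : ℂ) + y * I)))) + s ((((1 / 2 : ℝ)) : ℂ) + y * I) * conj (Ψ (-conj ((((1 / 2 : ℝ)) : ℂ) + y * I))))) =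
      fun y : ℝ => A y * (conj (A' y) + c y * conj (A' (-y))) := by
    funext y
    rw [axis_integrand_eq]
  have hG' : Integrable fun y : ℝ => A y * (conj (A' y) + c y * conj (A' (-y))) := by rw [← hint]; exact hG
  rw [hIP, hint, axisPairing_eq_setIntegral_Ioi (fun t => hs1 t) (fun t => hss t) hG']

/-- **THE NORM FORM OF THE HEAD** (`Ψ = Φ`): `IP = C·(ρ·|Φ(−1)|²) + C·(k·∫_0^∞ |U(t)|² dt)` — the squared norm of `Uθ = (Φ(−1), U)` in `ℂ ⊕ L²((0,∞))` with weights `(C·ρ, C·k)`; with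
`C·ρ, C·k > 0` this is the ISOMETRY clause of ROADCARD T5. [cite: MoeglinWaldspurger1995, IV.3.12] [cite: Iwaniec2002, §7.3] -/
theorem plancherelNorm_of_innerProductFormula (Φ s : ℂ → ℂ) {IP C ρ k : ℂ}
    (hIP : IP = C * (ρ * (Φ (-1) * conj (Φ (-1)))) + C * (k * ∫ y : ℝ, Φ (-((((1 / 2 : ℝ)) : ℂ) + y * I)) *
      (conj (Φ (-(1 - conj ((((1 / 2 : ℝ)) : ℂ) + y * I)))) + s ((((1 / 2 : ℝ)) : ℂ) + y * I) * conj (Φ (-conj ((((1 / 2 : ℝ)) : ℂ) + y * I))))))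
    (hs1 : ∀ t : ℝ, ‖s ((((1 / 2 : ℝ)) : ℂ) + t * I)‖ = 1) (hss : ∀ t : ℝ, s ((((1 / 2 : ℝ)) : ℂ) + ((-t : ℝ) : ℂ) * I) = conj (s ((((1 / 2 : ℝ)) : ℂ) + t * I)))
    (hG : Integrable fun y : ℝ => Φ (-((((1 / 2 : ℝ)) : ℂ) + y * I)) *
      (conj (Φ (-(1 - conj ((((1 / 2 : ℝ)) : ℂ) + y * I)))) + s ((((1 / 2 : ℝ)) : ℂ) + y * I) * conj (Φ (-conj ((((1 / 2 : ℝ)) : ℂ) + y * I))))) :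
    IP = C * (ρ * ((‖Φ (-1)‖ ^ 2 : ℝ) : ℂ)) + C * (k * ∫ t in Ioi (0 : ℝ),
      (((‖Φ (-((((1 / 2 : ℝ)) : ℂ) + t * I)) + s ((((1 / 2 : ℝ)) : ℂ) + ((-t : ℝ) : ℂ) * I) * Φ (-((((1 / 2 : ℝ)) : ℂ) + ((-t : ℝ) : ℂ) * I))‖ ^ 2 : ℝ)) : ℂ)) := by
  rw [plancherelForm_of_innerProductFormula Φ Φ s hIP hs1 hss hG, mul_conj, normSq_eq_norm_sq, ofReal_pow]
  congr 3
  refine setIntegral_congr_fun measurableSet_Ioi fun t _ => ?_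
  rw [mul_conj, normSq_eq_norm_sq, ofReal_pow]

/-! ## §5 (ED. 2) Finitely many simple real poles: the discrete part `ℂ^J` (self-dual `η`-type families; `J = ∅` allowed for pole-free families) -/

/-- **THE PLANCHEREL FORM WITH A FINITE DISCRETE PART** (dealer (152)): the same rearrangement when the contour shift produces finitely many residue terms at real points `z_j`
(`J` finite, possibly EMPTY — off-dual `χ`-families have no pole; the radial family has `J = {1}`): from
`IP = C·(∑_j ρ_j·Φ(−z_j)·conj Ψ(−z_j)) + C·(k·∫_ℝ (f3 integrand at ½+iy) dy)` and the unitary, reflection-symmetric axis scalar,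
**`IP = C·(∑_j ρ_j·Φ(−z_j)·conj Ψ(−z_j)) + C·(k·∫_0^∞ U(t)·conj U′(t) dt)`** — the pairing in `ℂ^J ⊕ L²((0,∞))` with weights `((C·ρ_j)_j, C·k)`.  (The residue block is carried
through verbatim; only the axis integral is rearranged, by `axisPairing_eq_setIntegral_Ioi`.) [cite: MoeglinWaldspurger1995, II.2.4, IV.3.12] [cite: Iwaniec2002, §7.3] -/
theorem plancherelForm_of_innerProductFormula_finset {ι : Type*} (J : Finset ι) (z : ι → ℝ) (ρ : ι → ℂ) (Φ Ψ s : ℂ → ℂ) {IP C k : ℂ}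
    (hIP : IP = C * (∑ j ∈ J, ρ j * (Φ (-((z j : ℝ) : ℂ)) * conj (Ψ (-((z j : ℝ) : ℂ))))) + C * (k * ∫ y : ℝ, Φ (-((((1 / 2 : ℝ)) : ℂ) + y * I)) *
      (conj (Ψ (-(1 - conj ((((1 / 2 : ℝ)) : ℂ) + y * I)))) + s ((((1 / 2 : ℝ)) : ℂ) + y * I) * conj (Ψ (-conj ((((1 / 2 : ℝ)) : ℂ) + y * I))))))
    (hs1 : ∀ t : ℝ, ‖s ((((1 / 2 : ℝ)) : ℂ) + t * I)‖ = 1) (hss : ∀ t : ℝ, s ((((1 / 2 : ℝ)) : ℂ) + ((-t : ℝ) : ℂ) * I) = conj (s ((((1 / 2 : ℝ)) : ℂ) + t * I)))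
    (hG : Integrable fun y : ℝ => Φ (-((((1 / 2 : ℝ)) : ℂ) + y * I)) *
      (conj (Ψ (-(1 - conj ((((1 / 2 : ℝ)) : ℂ) + y * I)))) + s ((((1 / 2 : ℝ)) : ℂ) + y * I) * conj (Ψ (-conj ((((1 / 2 : ℝ)) : ℂ) + y * I))))) :
    IP = C * (∑ j ∈ J, ρ j * (Φ (-((z j : ℝ) : ℂ)) * conj (Ψ (-((z j : ℝ) : ℂ))))) + C * (k * ∫ t in Ioi (0 : ℝ),
      (Φ (-((((1 / 2 : ℝ)) : ℂ) + t * I)) + s ((((1 / 2 : ℝ)) : ℂ) + ((-t : ℝ) : ℂ) * I) * Φ (-((((1 / 2 : ℝ)) : ℂ) + ((-t : ℝ) : ℂ) * I))) *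
        conj (Ψ (-((((1 / 2 : ℝ)) : ℂ) + t * I)) + s ((((1 / 2 : ℝ)) : ℂ) + ((-t : ℝ) : ℂ) * I) * Ψ (-((((1 / 2 : ℝ)) : ℂ) + ((-t : ℝ) : ℂ) * I)))) := by
  set A : ℝ → ℂ := fun t => Φ (-((((1 / 2 : ℝ)) : ℂ) + t * I)) with hA
  set A' : ℝ → ℂ := fun t => Ψ (-((((1 / 2 : ℝ)) : ℂ) + t * I)) with hA'
  set c : ℝ → ℂ := fun t => s ((((1 / 2 : ℝ)) : ℂ) + t * I) with hc
  have hint : (fun y : ℝ => Φ (-((((1 / 2 : ℝ)) : ℂ) + y * I)) *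
      (conj (Ψ (-(1 - conj ((((1 / 2 : ℝ)) : ℂ) + y * I)))) + s ((((1 / 2 : ℝ)) : ℂ) + y * I) * conj (Ψ (-conj ((((1 / 2 : ℝ)) : ℂ) + y * I))))) =
      fun y : ℝ => A y * (conj (A' y) + c y * conj (A' (-y))) := by
    funext y
    rw [axis_integrand_eq]
  have hG' : Integrable fun y : ℝ => A y * (conj (A' y) + c y * conj (A' (-y))) := by rw [← hint]; exact hG
  rw [hIP, hint, axisPairing_eq_setIntegral_Ioi (fun t => hs1 t) (fun t => hss t) hG']

/-- **NORM FORM WITH A FINITE DISCRETE PART** (`Ψ = Φ`): `IP = C·(∑_j ρ_j·|Φ(−z_j)|²) + C·(k·∫_0^∞ |U(t)|² dt)` — the squared norm of `Uθ = ((Φ(−z_j))_j, U)` in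
`ℂ^J ⊕ L²((0,∞))` with weights `((C·ρ_j)_j, C·k)`. [cite: MoeglinWaldspurger1995, IV.3.12] [cite: Iwaniec2002, §7.3] -/
theorem plancherelNorm_of_innerProductFormula_finset {ι : Type*} (J : Finset ι) (z : ι → ℝ) (ρ : ι → ℂ) (Φ s : ℂ → ℂ) {IP C k : ℂ}
    (hIP : IP = C * (∑ j ∈ J, ρ j * (Φ (-((z j : ℝ) : ℂ)) * conj (Φ (-((z j : ℝ) : ℂ))))) + C * (k * ∫ y : ℝ, Φ (-((((1 / 2 : ℝ)) : ℂ) + y * I)) *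
      (conj (Φ (-(1 - conj ((((1 / 2 : ℝ)) : ℂ) + y * I)))) + s ((((1 / 2 : ℝ)) : ℂ) + y * I) * conj (Φ (-conj ((((1 / 2 : ℝ)) : ℂ) + y * I))))))
    (hs1 : ∀ t : ℝ, ‖s ((((1 / 2 : ℝ)) : ℂ) + t * I)‖ = 1) (hss : ∀ t : ℝ, s ((((1 / 2 : ℝ)) : ℂ) + ((-t : ℝ) : ℂ) * I) = conj (s ((((1 / 2 : ℝ)) : ℂ) + t * I)))
    (hG : Integrable fun y : ℝ => Φ (-((((1 / 2 : ℝ)) : ℂ) + y * I)) *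
      (conj (Φ (-(1 - conj ((((1 / 2 : ℝ)) : ℂ) + y * I)))) + s ((((1 / 2 : ℝ)) : ℂ) + y * I) * conj (Φ (-conj ((((1 / 2 : ℝ)) : ℂ) + y * I))))) :
    IP = C * (∑ j ∈ J, ρ j * (((‖Φ (-((z j : ℝ) : ℂ))‖ ^ 2 : ℝ)) : ℂ)) + C * (k * ∫ t in Ioi (0 : ℝ),
      (((‖Φ (-((((1 / 2 : ℝ)) : ℂ) + t * I)) + s ((((1 / 2 : ℝ)) : ℂ) + ((-t : ℝ) : ℂ) * I) * Φ (-((((1 / 2 : ℝ)) : ℂ) + ((-t : ℝ) : ℂ) * I))‖ ^ 2 : ℝ)) : ℂ)) := by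
  rw [plancherelForm_of_innerProductFormula_finset J z ρ Φ Φ s hIP hs1 hss hG]
  have h1 : ∀ j, ρ j * (Φ (-((z j : ℝ) : ℂ)) * conj (Φ (-((z j : ℝ) : ℂ)))) = ρ j * (((‖Φ (-((z j : ℝ) : ℂ))‖ ^ 2 : ℝ)) : ℂ) := fun j => by
    rw [mul_conj, normSq_eq_norm_sq, ofReal_pow]
  simp only [h1]
  congr 3
  refine setIntegral_congr_fun measurableSet_Ioi fun t _ => ?_
  rw [mul_conj, normSq_eq_norm_sq, ofReal_pow]

end Summit.HodgeConjecture.HodgeConjecture.Cruxes.H413.K2E1PseudoEisensteinPlancherelIsometry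

end
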